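import Mathlib
import HarnessLib

/-!
# The Mahler measure of an integer polynomial: definition through `ℤ → ℂ` and first properties (re-homed proofs)

Basic facts about the Mahler measure `M(p)` of an INTEGER polynomial `p` (through the embedding `ℤ → ℂ` and Mathlib's
`Polynomial.mahlerMeasure`; McKee–Smyth, *Around the Unit Circle*, §1.2: `M(P) = |a_0| ∏ max(1, |α_i|)`, "clearly
`M(P) ≥ |a_0| ≥ 1`"), RE-HOMED into `Literature/` by the Hodge foundations lane (`lit-hodgefound`, seat p20, generation 36) from
the venture cell `pub-namedobj` (`Summits/Ventures/DiscreteObjects/Mahler/`, several seats), as the common base of the lane's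
Mahler-measure ports (Smyth's theorem, the fewnomial bounds, the cyclotomic-integer height bound, Dobrowolski's theorem):
verbatim DECLARATION-LEVEL ports (Parts 1–8, each naming its source module; only the generic declarations of those modules are
taken here, the rest travel with the theorems they serve) of: the definition `intMahlerMeasure p` (`SmallMeasureCensus`);
`M(−p) = M(p)`, `M(p(−x)) = M(p)`, `M ≥ 0`, `M(p·p(−x)) = M(p)²` (`GraeffeIdentity`); norms and evaluations of
`∏ (X − a)` over a multiset (`BlaschkeData`); `|lead p| ≤ M(p)` and `|p(0)| ≤ M(p)` for monic `p` (`NonreciprocalMeasureBound`,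
McKee–Smyth (12.10) context); every complex root has modulus `≤ M(p)` (`LehmerLowerBound`); multiplicativity `M(pq) = M(p)M(q)`,
`1 ≤ M(p)` for `p ≠ 0`, `M(C a) = |a|`, `M(X) = 1`, `M(Φ_n) = 1` (`SubLehmerDegree56`); `M(∏(X − a)) = ∏ max(1,|a|)`,
`M(p^n) = M(p)^n` (`CyclotomicIntegerLehmer`); `M(x^k − a) = max(1, |a|)` and `M(p(x^k)) = M(p)` (`MahlerMeasureCompXPow`).
Namespace `Summit.Ventures.DiscreteObjects.Mahler` re-rooted as `Literature.NumberTheory.MahlerMeasure` (this file's path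
namespace).  One definition (`intMahlerMeasure`, body verbatim), theorems otherwise; no named fact; imports Mathlib only; every
declaration carries the McKee–Smyth §1.2 citation of the notion it serves (the Summits originals carry docstrings without tags).
The Summits originals stay in place (transitional duplication; twins = same short names in `Summit.Ventures.DiscreteObjects.Mahler`).
-/

noncomputable section

/-!
## Part 1 — port of `Summits/Ventures/DiscreteObjects/Mahler/SmallMeasureCensus.lean` (1 declarations kept)

The Mahler measure of an integer polynomial through the embedding `ℤ → ℂ` (source module `SmallMeasureCensus`; its census statements are not ported).
-/

section Part1

namespace Literature.NumberTheory.MahlerMeasure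

open _root_.Polynomial

/-- The Mahler measure of an integer polynomial, through the embedding `ℤ → ℂ`.
[cite: MckeeSmyth2021, §1.2 p.21 (definition and first properties of M(P))] -/
noncomputable def intMahlerMeasure (p : ℤ[X]) : ℝ :=
  (p.map (Int.castRingHom ℂ)).mahlerMeasure

end Literature.NumberTheory.MahlerMeasure

end Part1

/-!
## Part 2 — port of `Summits/Ventures/DiscreteObjects/Mahler/GraeffeIdentity.lean` (5 declarations kept)

`M(−p) = M(p)`, `M(p(−x)) = M(p)` (root factorisation over `ℂ`), `0 ≤ M`, `M(p · p(−x)) = M(p)²` (source module `GraeffeIdentity`; the Graeffe identity itself and the rejection certificate are not ported here).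
-/

section Part2

namespace Literature.NumberTheory.MahlerMeasure

open _root_.Polynomial

/-- `M(−p) = M(p)`. [cite: MckeeSmyth2021, §1.2 p.21 (definition and first properties of M(P))] -/
theorem mahlerMeasure_neg (p : ℂ[X]) : (-p).mahlerMeasure = p.mahlerMeasure := by
  rw [show -p = C (-1) * p by simp, mahlerMeasure_mul, mahlerMeasure_const]
  simp

/-- `M(p(−x)) = M(p)`: the roots are negated, the leading coefficient changes at most by a sign.
[cite: MckeeSmyth2021, §1.2 p.21 (definition and first properties of M(P))] -/
theorem mahlerMeasure_comp_neg_X (p : ℂ[X]) : (p.comp (-X)).mahlerMeasure = p.mahlerMeasure := by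
  have hs := (IsAlgClosed.splits p).eq_prod_roots
  have h1 : (p.comp (-X)).mahlerMeasure =
      ‖p.leadingCoeff‖ * (p.roots.map (fun a ↦ max 1 ‖a‖)).prod := by
    conv_lhs => rw [hs]
    rw [mul_comp, C_comp, multiset_prod_comp, mahlerMeasure_mul, mahlerMeasure_const,
      prod_mahlerMeasure_eq_mahlerMeasure_prod, Multiset.map_map, Multiset.map_map]
    congr 1
    apply congrArg
    apply Multiset.map_congr rfl
    intro a _
    simp only [Function.comp_apply, sub_comp, X_comp, C_comp]
    rw [show (-X - C a : ℂ[X]) = -(X + C a) by ring, mahlerMeasure_neg, mahlerMeasure_X_add_C]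
  rw [h1, mahlerMeasure_eq_leadingCoeff_mul_prod_roots]

/-- `M(−p) = M(p)` for integer polynomials.
[cite: MckeeSmyth2021, §1.2 p.21 (definition and first properties of M(P))] -/
theorem intMahlerMeasure_neg (p : ℤ[X]) : intMahlerMeasure (-p) = intMahlerMeasure p := by
  unfold intMahlerMeasure
  rw [Polynomial.map_neg, mahlerMeasure_neg]

/-- `0 ≤ M(p)` for integer polynomials. [cite: MckeeSmyth2021, §1.2 p.21 (definition and first properties of M(P))] -/
theorem intMahlerMeasure_nonneg (p : ℤ[X]) : 0 ≤ intMahlerMeasure p := by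
  unfold intMahlerMeasure
  exact mahlerMeasure_nonneg _

/-- `M(p(x)·p(−x)) = M(p)²` for integer polynomials.
[cite: MckeeSmyth2021, §1.2 p.21 (definition and first properties of M(P))] -/
theorem intMahlerMeasure_mul_comp_neg_X (p : ℤ[X]) :
    intMahlerMeasure (p * p.comp (-X)) = intMahlerMeasure p ^ 2 := by
  unfold intMahlerMeasure
  rw [Polynomial.map_mul, mahlerMeasure_mul, map_comp]
  simp only [Polynomial.map_neg, map_X]
  rw [mahlerMeasure_comp_neg_X, sq]

end Literature.NumberTheory.MahlerMeasure

end Part2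

/-!
## Part 3 — port of `Summits/Ventures/DiscreteObjects/Mahler/BlaschkeData.lean` (4 declarations kept)

Norms, non-vanishing and evaluation of finite products `∏ (X − a)` over a multiset of complex numbers (source module `BlaschkeData`; the Blaschke data themselves are ported with Smyth's theorem).
-/

section Part3

namespace Literature.NumberTheory.MahlerMeasure

open _root_.Polynomial _root_.Complex _root_.Metric _root_.Set _root_.Filter _root_.Topology
open scoped ComplexConjugate

/-! ### Integer side: the first non-palindromic coefficient -/

/-- Norms of multiset products compare factorwise.
[cite: MckeeSmyth2021, §1.2 p.21 (definition and first properties of M(P))] -/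
theorem norm_multiset_prod_le {s : Multiset ℂ} {φ χ : ℂ → ℂ} (h : ∀ α ∈ s, ‖φ α‖ ≤ ‖χ α‖) :
    ‖(s.map φ).prod‖ ≤ ‖(s.map χ).prod‖ := by
  induction s using Multiset.induction_on with
  | empty => simp
  | cons b t ih =>
    simp only [Multiset.map_cons, Multiset.prod_cons, norm_mul]
    have hb := h b (Multiset.mem_cons_self b t)
    have ht := ih (fun α hα => h α (Multiset.mem_cons_of_mem hα))
    exact mul_le_mul hb ht (norm_nonneg _) (norm_nonneg _)

/-- The norm of a multiset product over `ℂ` is the product of the norms.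
[cite: MckeeSmyth2021, §1.2 p.21 (definition and first properties of M(P))] -/
theorem norm_multiset_prod_eq (s : Multiset ℂ) (φ : ℂ → ℂ) :
    ‖(s.map φ).prod‖ = (s.map fun α => ‖φ α‖).prod := by
  induction s using Multiset.induction_on with
  | empty => simp
  | cons b t ih => simp [ih]

/-- A multiset product over `ℂ` with nonzero factors is nonzero.
[cite: MckeeSmyth2021, §1.2 p.21 (definition and first properties of M(P))] -/
theorem multiset_prod_ne_zero {s : Multiset ℂ} {φ : ℂ → ℂ} (h : ∀ α ∈ s, φ α ≠ 0) :
    (s.map φ).prod ≠ 0 := by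
  rw [Ne, Multiset.prod_eq_zero_iff, Multiset.mem_map]
  rintro ⟨α, hα, h0⟩
  exact h α hα h0

/-- Evaluation of a product of linear factors.
[cite: MckeeSmyth2021, §1.2 p.21 (definition and first properties of M(P))] -/
theorem eval_multiset_prod_X_sub_C (s : Multiset ℂ) (z : ℂ) :
    ((s.map fun α => X - C α).prod).eval z = (s.map fun α => z - α).prod := by
  rw [eval_multiset_prod, Multiset.map_map]; congr 1
  apply Multiset.map_congr rfl; intro α _; simp

end Literature.NumberTheory.MahlerMeasure

end Part3

/-!
## Part 4 — port of `Summits/Ventures/DiscreteObjects/Mahler/NonreciprocalMeasureBound.lean` (2 declarations kept)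

`|lead P| ≤ M(P)` and, for monic `P`, `|P(0)| ≤ M(P)` (source module `NonreciprocalMeasureBound`; McKee–Smyth §12.2.1: "`P(0) = ±1` for otherwise `M(P) ≥ 2`").
-/

section Part4

namespace Literature.NumberTheory.MahlerMeasure

open _root_.Polynomial _root_.Complex _root_.Metric _root_.Set _root_.Filter _root_.Topology
open scoped ComplexConjugate

/-! ### Averaging over the `k`-th roots of unity -/

/-- `|lc P| ≤ M(P)`. [cite: MckeeSmyth2021, §1.2 p.21 (definition and first properties of M(P))] -/
theorem abs_leadingCoeff_le_intMahlerMeasure (P : ℤ[X]) :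
    (|P.leadingCoeff| : ℝ) ≤ intMahlerMeasure P := by
  unfold intMahlerMeasure
  have h := leadingCoeff_le_mahlerMeasure (P.map (Int.castRingHom ℂ))
  rw [leadingCoeff_map_of_injective (RingHom.injective_int _), eq_intCast, Complex.norm_intCast] at h
  exact h

/-- For monic `P`: `|P(0)| ≤ M(P)` (the product of all the roots is `± P(0)`).
[cite: MckeeSmyth2021, §1.2 p.21 (definition and first properties of M(P))] -/
theorem abs_coeff_zero_le_intMahlerMeasure {P : ℤ[X]} (hmonic : P.Monic) :
    (|P.coeff 0| : ℝ) ≤ intMahlerMeasure P := by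
  classical
  set Pc := P.map (Int.castRingHom ℂ) with hPc
  have hPcm : Pc.Monic := hmonic.map _
  set S := Pc.roots with hSdef
  have hcard : Multiset.card S = Pc.natDegree := IsAlgClosed.card_roots_eq_natDegree
  have hprod : (S.map fun α => X - C α).prod = Pc :=
    prod_multiset_X_sub_C_of_monic_of_roots_card_eq hPcm hcard
  have h0 : ‖Pc.eval 0‖ = (S.map fun α => ‖α‖).prod := by
    rw [← hprod, eval_multiset_prod_X_sub_C, norm_multiset_prod_eq]
    congr 1; apply Multiset.map_congr rfl; intro α _; simp
  have h1 : (S.map fun α => ‖α‖).prod ≤ (S.map fun α => max 1 ‖α‖).prod := by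
    have := norm_multiset_prod_le (s := S) (φ := fun α => (‖α‖ : ℂ)) (χ := fun α => ((max 1 ‖α‖ : ℝ) : ℂ))
      (fun α _ => by
        rw [Complex.norm_real, Complex.norm_real, Real.norm_of_nonneg (norm_nonneg _),
          Real.norm_of_nonneg (le_trans zero_le_one (le_max_left _ _))]
        exact le_max_right _ _)
    rw [norm_multiset_prod_eq, norm_multiset_prod_eq] at this
    have e1 : (S.map fun α => ‖((‖α‖ : ℝ) : ℂ)‖) = S.map fun α => ‖α‖ := by
      apply Multiset.map_congr rfl; intro α _
      rw [Complex.norm_real, Real.norm_of_nonneg (norm_nonneg _)]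
    have e2 : (S.map fun α => ‖((max 1 ‖α‖ : ℝ) : ℂ)‖) = S.map fun α => max 1 ‖α‖ := by
      apply Multiset.map_congr rfl; intro α _
      rw [Complex.norm_real, Real.norm_of_nonneg (le_trans zero_le_one (le_max_left _ _))]
    rwa [e1, e2] at this
  have hev : ‖Pc.eval 0‖ = (|P.coeff 0| : ℝ) := by
    rw [← coeff_zero_eq_eval_zero, hPc, coeff_map, eq_intCast, Complex.norm_intCast]
  unfold intMahlerMeasure
  rw [← hPc, mahlerMeasure_eq_leadingCoeff_mul_prod_roots, hPcm.leadingCoeff, norm_one, one_mul, ← hSdef,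
    ← hev, h0]
  exact h1

/-! ### The theorem -/

end Literature.NumberTheory.MahlerMeasure

end Part4

/-!
## Part 5 — port of `Summits/Ventures/DiscreteObjects/Mahler/LehmerLowerBound.lean` (3 declarations kept)

Every complex root of `p ∈ ℤ[X]` has modulus at most `M(p)` (source module `LehmerLowerBound`).
-/

section Part5

namespace Literature.NumberTheory.MahlerMeasure

open _root_.Polynomial

/-- A product of reals that are all `≥ 1` is `≥ 1`.
[cite: MckeeSmyth2021, §1.2 p.21 (definition and first properties of M(P))] -/
theorem one_le_multiset_prod {t : Multiset ℝ} (h : ∀ y ∈ t, 1 ≤ y) : 1 ≤ t.prod := by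
  induction t using Multiset.induction_on with
  | empty => simp
  | cons a u ih =>
    rw [Multiset.prod_cons]
    have ha : 1 ≤ a := h a (Multiset.mem_cons_self a u)
    have hu : 1 ≤ u.prod := ih (fun y hy => h y (Multiset.mem_cons_of_mem hy))
    nlinarith

/-- In a multiset of reals that are all `≥ 1`, every member is at most the product.
[cite: MckeeSmyth2021, §1.2 p.21 (definition and first properties of M(P))] -/
theorem le_prod_of_mem_of_one_le {s : Multiset ℝ} (h : ∀ y ∈ s, 1 ≤ y) {x : ℝ} (hx : x ∈ s) :
    x ≤ s.prod := by
  obtain ⟨t, rfl⟩ := Multiset.exists_cons_of_mem hx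
  rw [Multiset.prod_cons]
  have h1 : (1 : ℝ) ≤ t.prod := one_le_multiset_prod (fun y hy => h y (Multiset.mem_cons_of_mem hy))
  have hx1 : 0 ≤ x := le_trans zero_le_one (h x (Multiset.mem_cons_self x t))
  nlinarith

/-- The modulus of any complex root of a monic integer polynomial is at most its Mahler measure.
[cite: MckeeSmyth2021, §1.2 p.21 (definition and first properties of M(P))] -/
theorem norm_root_le_intMahlerMeasure {p : ℤ[X]} (hp : p.Monic) {z : ℂ}
    (hz : aeval z p = 0) : ‖z‖ ≤ intMahlerMeasure p := by
  unfold intMahlerMeasure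
  set q : ℂ[X] := p.map (Int.castRingHom ℂ) with hq
  have hqm : q.Monic := hp.map _
  have hq0 : q ≠ 0 := hqm.ne_zero
  rw [mahlerMeasure_eq_leadingCoeff_mul_prod_roots, hqm.leadingCoeff, norm_one, one_mul]
  have hzr : z ∈ q.roots := by
    rw [mem_roots hq0, IsRoot.def, hq, eval_map]
    rwa [aeval_def, algebraMap_int_eq] at hz
  have hmem : max 1 ‖z‖ ∈ q.roots.map (fun a => max 1 ‖a‖) := Multiset.mem_map_of_mem _ hzr
  have hall : ∀ y ∈ q.roots.map (fun a => max 1 ‖a‖), 1 ≤ y := by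
    intro y hy
    obtain ⟨a, _, rfl⟩ := Multiset.mem_map.mp hy
    exact le_max_left _ _
  exact le_trans (le_max_right 1 ‖z‖) (le_prod_of_mem_of_one_le hall hmem)

end Literature.NumberTheory.MahlerMeasure

end Part5

/-!
## Part 6 — port of `Summits/Ventures/DiscreteObjects/Mahler/SubLehmerDegree56.lean` (5 declarations kept)

Multiplicativity `M(pq) = M(p) M(q)`, `1 ≤ M(p)` for `p ≠ 0`, `M(C a) = |a|`, `M(X) = 1`, `M(Φ_n) = 1` (source module `SubLehmerDegree56`; the degree-56 census material is not ported).
-/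

section Part6

namespace Literature.NumberTheory.MahlerMeasure

open _root_.Polynomial Literature.NumberTheory.MahlerMeasure

/-- Multiplicativity of the integer Mahler measure (from Mathlib's `mahlerMeasure_mul`).
[cite: MckeeSmyth2021, §1.2 p.21 (definition and first properties of M(P))] -/
theorem intMahlerMeasure_mul (p q : ℤ[X]) :
    intMahlerMeasure (p * q) = intMahlerMeasure p * intMahlerMeasure q := by
  unfold intMahlerMeasure
  rw [Polynomial.map_mul, mahlerMeasure_mul]

/-- A nonzero integer polynomial has Mahler measure `≥ 1` (Mathlib).
[cite: MckeeSmyth2021, §1.2 p.21 (definition and first properties of M(P))] -/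
theorem one_le_intMahlerMeasure {p : ℤ[X]} (hp : p ≠ 0) : 1 ≤ intMahlerMeasure p :=
  one_le_mahlerMeasure_of_ne_zero hp

/-- The Mahler measure of an integer constant is its absolute value.
[cite: MckeeSmyth2021, §1.2 p.21 (definition and first properties of M(P))] -/
theorem intMahlerMeasure_C (c : ℤ) : intMahlerMeasure (C c) = |(c : ℝ)| := by
  unfold intMahlerMeasure
  rw [Polynomial.map_C, mahlerMeasure_const]
  simp

/-- The Mahler measure of `x` is `1`. [cite: MckeeSmyth2021, §1.2 p.21 (definition and first properties of M(P))] -/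
theorem intMahlerMeasure_X : intMahlerMeasure (X : ℤ[X]) = 1 := by
  unfold intMahlerMeasure
  rw [Polynomial.map_X]
  have hX : (X : ℂ[X]) = X - C 0 := by simp
  rw [hX, mahlerMeasure_X_sub_C]
  simp

/-- The Mahler measure of a cyclotomic polynomial is `1` (Mathlib, in the cell's vocabulary).
[cite: MckeeSmyth2021, §1.2 p.21 (definition and first properties of M(P))] -/
theorem intMahlerMeasure_cyclotomic (n : ℕ) : intMahlerMeasure (cyclotomic n ℤ) = 1 := by
  unfold intMahlerMeasure
  rw [← algebraMap_int_eq]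
  exact cyclotomic_mahlerMeasure_eq_one n

end Literature.NumberTheory.MahlerMeasure

end Part6

/-!
## Part 7 — port of `Summits/Ventures/DiscreteObjects/Mahler/CyclotomicIntegerLehmer.lean` (2 declarations kept)

`M(∏ (X − a_i)) = ∏ max(1, ‖a_i‖)` and `M(p^n) = M(p)^n` (source module `CyclotomicIntegerLehmer`; the cyclotomic-integer theorems are ported in `CyclotomicIntegerHeightBound.lean`).
-/

section Part7

namespace Literature.NumberTheory.MahlerMeasure

open _root_.Polynomial _root_.Finset

/-- Mahler measure of a product of linear factors.
[cite: MckeeSmyth2021, §1.2 p.21 (definition and first properties of M(P))] -/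
theorem mahlerMeasure_prod_X_sub_C (s : Finset ℂ) (a : ℂ → ℂ) :
    (∏ x ∈ s, (X - C (a x))).mahlerMeasure = ∏ x ∈ s, max 1 ‖a x‖ := by
  classical
  induction s using Finset.induction_on with
  | empty => simp [mahlerMeasure_one]
  | insert x s hx ih => rw [Finset.prod_insert hx, Finset.prod_insert hx, mahlerMeasure_mul, mahlerMeasure_X_sub_C, ih]

/-- `M(f^e) = M(f)^e` for `f ∈ ℤ[X]`. [cite: MckeeSmyth2021, §1.2 p.21 (definition and first properties of M(P))] -/
theorem intMahlerMeasure_pow (f : ℤ[X]) (e : ℕ) : intMahlerMeasure (f ^ e) = intMahlerMeasure f ^ e := by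
  induction e with
  | zero =>
    rw [pow_zero, pow_zero]
    unfold intMahlerMeasure
    rw [Polynomial.map_one, mahlerMeasure_one]
  | succ e ih => rw [pow_succ, intMahlerMeasure_mul, ih, pow_succ]

end Literature.NumberTheory.MahlerMeasure

end Part7

/-!
## Part 8 — port of `Summits/Ventures/DiscreteObjects/Mahler/MahlerMeasureCompXPow.lean` (4 declarations kept)

`(max 1 t)^k = max 1 (t^k)`, `M(x^k − a) = max(1, ‖a‖)` (`k ≥ 1`), and `M(p(x^k)) = M(p)` for every `k ≥ 1` (source module `MahlerMeasureCompXPow`; the sharpness of Smyth's bound is ported with Smyth's theorem).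
-/

section Part8

namespace Literature.NumberTheory.MahlerMeasure

open _root_.Polynomial

/-- For `t ≥ 0` and any `k`: `(max 1 t)^k = max 1 (t^k)`.
[cite: MckeeSmyth2021, §1.2 p.21 (definition and first properties of M(P))] -/
theorem max_one_pow {t : ℝ} (ht : 0 ≤ t) (k : ℕ) : (max 1 t) ^ k = max 1 (t ^ k) := by
  rcases le_total t 1 with h | h
  · rw [max_eq_left h, one_pow, max_eq_left (pow_le_one₀ ht h)]
  · rw [max_eq_right h, max_eq_right (one_le_pow₀ h)]

/-- `M(x^k - a) = max(1, ‖a‖)` for `k ≥ 1`: the roots are the `k`-th roots of `a`.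
[cite: MckeeSmyth2021, §1.2 p.21 (definition and first properties of M(P))] -/
theorem mahlerMeasure_X_pow_sub_C {k : ℕ} (hk : 1 ≤ k) (a : ℂ) :
    (X ^ k - C a : ℂ[X]).mahlerMeasure = max 1 ‖a‖ := by
  have hk0 : k ≠ 0 := by omega
  have hmonic : (X ^ k - C a : ℂ[X]).Monic := monic_X_pow_sub_C a hk0
  rw [mahlerMeasure_eq_leadingCoeff_mul_prod_roots, hmonic.leadingCoeff, norm_one, one_mul]
  have hroots : ∀ β ∈ (X ^ k - C a : ℂ[X]).roots, max 1 ‖β‖ = max 1 (‖a‖ ^ ((1 : ℝ) / k)) := by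
    intro β hβ
    have hβk : β ^ k = a := by
      have := (mem_roots hmonic.ne_zero).mp hβ
      rw [IsRoot, eval_sub, eval_pow, eval_X, eval_C, sub_eq_zero] at this
      exact this
    congr 1
    have h1 : ‖β‖ ^ k = ‖a‖ := by rw [← norm_pow, hβk]
    rw [← h1, ← Real.rpow_natCast, ← Real.rpow_mul (norm_nonneg β)]
    rw [mul_one_div_cancel (by exact_mod_cast hk0), Real.rpow_one]
  have hcard : Multiset.card (X ^ k - C a : ℂ[X]).roots = k := by
    have hs := (IsAlgClosed.splits (X ^ k - C a : ℂ[X])).natDegree_eq_card_roots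
    rw [natDegree_X_pow_sub_C] at hs
    exact hs.symm
  rw [Multiset.map_congr rfl hroots, Multiset.map_const', Multiset.prod_replicate, hcard,
    max_one_pow (by positivity), ← Real.rpow_natCast, ← Real.rpow_mul (norm_nonneg a),
    one_div_mul_cancel (by exact_mod_cast hk0), Real.rpow_one]

/-- **`M(p(x^k)) = M(p)`** for every complex polynomial `p` and `k ≥ 1`.
[cite: MckeeSmyth2021, §1.2 p.21 (definition and first properties of M(P))] -/
theorem mahlerMeasure_comp_X_pow (p : ℂ[X]) {k : ℕ} (hk : 1 ≤ k) :
    (p.comp (X ^ k)).mahlerMeasure = p.mahlerMeasure := by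
  have hs := (IsAlgClosed.splits p).eq_prod_roots
  have h1 : (p.comp (X ^ k)).mahlerMeasure =
      ‖p.leadingCoeff‖ * (p.roots.map (fun a ↦ max 1 ‖a‖)).prod := by
    conv_lhs => rw [hs]
    rw [mul_comp, C_comp, multiset_prod_comp, mahlerMeasure_mul, mahlerMeasure_const,
      prod_mahlerMeasure_eq_mahlerMeasure_prod, Multiset.map_map, Multiset.map_map]
    congr 1
    apply congrArg
    apply Multiset.map_congr rfl
    intro a _
    simp only [Function.comp_apply, sub_comp, X_comp, C_comp]
    exact mahlerMeasure_X_pow_sub_C hk a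
  rw [h1, mahlerMeasure_eq_leadingCoeff_mul_prod_roots]

/-- `M(q(x^k)) = M(q)` for integer polynomials and `k ≥ 1`.
[cite: MckeeSmyth2021, §1.2 p.21 (definition and first properties of M(P))] -/
theorem intMahlerMeasure_comp_X_pow (q : ℤ[X]) {k : ℕ} (hk : 1 ≤ k) :
    intMahlerMeasure (q.comp (X ^ k)) = intMahlerMeasure q := by
  unfold intMahlerMeasure
  rw [map_comp]
  simp only [Polynomial.map_pow, map_X]
  exact mahlerMeasure_comp_X_pow _ hk

/-! ### Sharpness of Smyth's bound -/

end Literature.NumberTheory.MahlerMeasure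

end Part8

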